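import Summits.BirchSwinnertonDyer.Rank1Residual.X5.TwoAdicTargetsEndState
import Summits.BirchSwinnertonDyer.Rank1Residual.X5.TwoAdicTargetsPub
import Literature.NumberTheory.EllipticCurves.PAdicLFunctionIntegralityAtTwoProofs
import Literature.NumberTheory.EllipticCurves.SkinnerUrban2014.PAdicUnitPeriodRatioAnyPrimeProofs
import Literature.NumberTheory.EllipticCurves.NonEisensteinPrimeOfSurjective
import HarnessLib

/-!
# Class O1 (X5, `p = 2`, non-CM): the END-STATE on O1-A-go ∧ r0 with the period slack and the
# `L₂`-denominator slack DISCHARGED BY THEOREMS (`m = 0`, `ν₂ = 0`)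

HONEST FRAMING (cell `b2b-bsdres`, run/shared/lean/b2b/bsd-rank1-residual/, verbatim in every
file): the goal of the cell is to DELETE the COMBINATION-SHAPED residual classes of the
Birch–Swinnerton-Dyer formula for ALL analytic-rank `≤ 1` elliptic curves over `ℚ` — "full BSD
formula for every rank `≤ 1` curve in class `C`" assembled STRICTLY from published theorems — so
that the rank-`≤ 1` remainder becomes exactly the CONSTRUCTION-SHAPED classes, which are TYPED
(missing-input `Prop`s), NOT attempted. This is not "finishing BSD". Research routes; no claim
beyond stated classes; census output = EVIDENCE, never a Literature fact; nothing here is booked;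
no mark of RESIDUAL-MAP §I moves.

Unit `b2b-bsdres-cc-typer-4` (lane CLASS-CLOSURE, class O1), gen 2, twelfth file of the O1 typer
folder. The o1 class lead's PLAN v2.2 (`HOME/cells/o1/PLAN.md` §10.3 C24, §10.5 C25b/c) names two
slack sources of the END-STATE at `2` besides the Euler-system loss `k`: the PERIOD slack `m`
(`−m ≤ ord₂ ϖ`, `ϖ · Ω_E = Ω⁺_f`; "A-PER2") and the DENOMINATOR slack `ν₂` (`2^{ν₂} L₂ ∈ Λ`; "T-INT2 /
G12"). Both are now ZERO BY THEOREM on sub-class O1-A-go (good ordinary `2`, `ρ_{E,2^∞}` surjective):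

* `ν₂ = 0`: `Literature/…/PAdicLFunctionIntegralityAtTwoProofs.lean` (p253120, this seat):
  `padicLFunction_integral_two`, `exists_iwasawaToPowerSeries_eq_padicLFunction_two` — `L₂(f, α, T) ∈
  ℤ₂⟦T⟧` at a good ordinary `2` with `E[2]` irreducible, UNCONDITIONALLY (Δ-doubling of the Riemann
  sums + `[x]⁺ = k/(2n₀)` for real-coefficient forms + the discharged DDT 2.6(b) fact).
* `m = 0`: `Literature/…/SkinnerUrban2014/PAdicUnitPeriodRatioAnyPrimeProofs.lean` (p253612, this
  seat): `realPeriodRat_eq_unit_mul_plusPeriod_two_of_abbesUllmo` — `Ω(W) = u · Ω⁺_f`, `‖u‖₂ = 1` at a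
  good `2` with `E[2]` irreducible, PROVED modulo the PUBLISHED Manin-constant fact
  `abbesUllmo_not_dvd_maninConstant_of_not_dvd_level` (Abbes–Ullmo 1996 Thm. A; a named Literature
  fact, not minted here); Greenberg–Vatsal 2000 Rem. 3.4 at `2` with NO factor-`2` slack (`re Λ_E =
  ℤ · Ω(W)/2` exactly; `Ω(E₀) = |c₀| · Ω⁺_f` exactly).

Contents (THEOREMS ONLY; no definition, no named fact):
* §1 `irr_two_of_twoAdicSurjective`: `TwoAdicSurjective W → Irr W 2` (surjective mod `2` ⇒
  irreducible; `hasIrreducibleModPGaloisRep_of_hasSurjectiveModNGaloisRep`).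
* §2 `exists_integral_twoAdicLFunction` (T-INT2 in O1 currency) and
  `divisibilityUpTo_iff_mem_charIdeal`: with `ι G = L₂`, the E2 datum "`ι g = 2ⁿ · L₂` for some
  `g ∈ char_Λ X`" is EQUIVALENT to "`2ⁿ · G ∈ char_Λ X`" INSIDE `Λ` — the statement the PLAN's C25b
  ("UFD step": `f_X ∣ 2ⁿ G ⟺ μ₂(X) ≤ n + μ(G)`, sibling `X5/TwoAdicTargetsMuGap.lean`) starts from;
  `katoDivisibilityAtTwoUpTo_iff_mem_charIdeal`.
* §3 the END-STATE with `m = 0` supplied by the theorem: `upperBoundAtTwo_goodOrd_of_kato_of_abbesUllmo`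
  (`ord₂ #Ш ≤ ord₂ #Ш_an + k`), `bsdp_two_goodOrd_of_kato_le_one_of_abbesUllmo` and the fully
  cited form **`bsdp_two_goodOrd_of_kato_le_one_of_facts`**: on O1-A-go ∧ r0,
  `BSD(E,2)` ⟸ the ONE open target `KatoDivisibilityAtTwoUpTo W k f` with `k ≤ 1` + a certified lower
  bound `MissingLowerBoundAt W 2` + the rank-`0` parity certificate `ShaAnTwoAdicValEven W`, MODULO the
  published named facts Cassels–Tate (`exists_casselsTate_pairing`), Greenberg 1999 Thm. 4.1 any prime
  (`Greenberg1999.thm41_charValue_rankZero_anyPrime`), modularity (`nonempty_modularParametrizationData`),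
  Gross–Zagier–Kolyvagin (`rank_eq_analyticRank_of_analyticRank_le_one`), Abbes–Ullmo Thm. A.

Nothing is booked: `KatoDivisibilityAtTwoUpTo W k f` at `k ≤ 1` is NOT in print (Kato 17.4 (3) / 13.4
(3) / 17.13 at `p = 2`), and the lower bound is a per-pair certificate.

References: [GreenbergLNM1716] Thm. 4.1; [Kato2004Asterisque] Thm. 17.4; [GreenbergVatsal2000] §3
Rem. 3.4, Prop. 3.7; [AbbesUllmo1996] Thm. A; [Cesnavicius2018] Thm. 1.2; [Miller2011LMS] Def. 1.1;
[SilvermanAEC2009] Thm. X.4.14; [MazurTateTeitelbaum1986Invent] §I.12–I.13.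
-/

set_option autoImplicit false

noncomputable section

open scoped Classical MatrixGroups ModularForm

open CongruenceSubgroup WeierstrassCurve Literature.NumberTheory.EllipticCurves
  Literature.NumberTheory.EllipticCurves.ModularForms
  Literature.NumberTheory.EllipticCurves.Wuthrich2014
  Literature.NumberTheory.EllipticCurves.Rank1Residual
  Literature.NumberTheory.EllipticCurves.Rank1Residual.Typed
  Literature.NumberTheory.EllipticCurves.SkinnerUrban2014

namespace Summit.BirchSwinnertonDyer.Rank1Residual.X5.O1

variable (W : WeierstrassCurve ℚ) [W.IsElliptic] [W.IsGloballyMinimal]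

/-! ## §1 The big-image locus lies in the irreducible locus -/

omit [W.IsGloballyMinimal] in
/-- `ρ_{E,2^∞}` surjective ⇒ `ρ̄_{E,2}` surjective (`n = 1`) ⇒ `E[2]` irreducible (a surjective
mod-`p` representation is irreducible: `hasIrreducibleModPGaloisRep_of_hasSurjectiveModNGaloisRep`,
Serre 1972 §4). So sub-class O1-A lies inside the `E[2]`-irreducible locus where T-INT2 and A-PER2
are theorems. [cite: Serre1972, §4 (surjective ⇒ irreducible; folklore)] -/
theorem irr_two_of_twoAdicSurjective (him : TwoAdicSurjective W) : Irr W 2 := by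
  have h1 : W.HasSurjectiveModNGaloisRep ((2 : ℕ) : ℤ) := by
    have h := him 1 one_pos
    simpa using h
  exact hasIrreducibleModPGaloisRep_of_hasSurjectiveModNGaloisRep W 2 h1

/-! ## §2 T-INT2 in O1 currency: `ν₂ = 0`, and the E2 datum read inside `Λ` -/

/-- **T-INT2 (ν₂ = 0) on O1-go ∩ Irr, a THEOREM**: at a good ordinary `2` with `E[2]` irreducible
the `2`-adic `L`-function of the newform `f` of `E` lies in `Λ = ℤ₂⟦T⟧`: `ι G = L₂(f, α, T)` for a
(unique) `G ∈ Λ`. Pointer to `exists_iwasawaToPowerSeries_eq_padicLFunction_two`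
(`PAdicLFunctionIntegralityAtTwoProofs`, unconditional). In particular no power of `2` in the E2
target `KatoDivisibilityAtTwoUpTo W k f` is spent on denominators of `L₂` (o1 PLAN C25b/c).
[cite: GreenbergVatsal2000, Prop. 3.7 (mechanism; odd p in print)] [cite: MazurTateTeitelbaum1986Invent, §I.12] -/
theorem exists_integral_twoAdicLFunction (hgo : CellGoodOrd W) (hirr : Irr W 2) {N : ℕ} [NeZero N]
    (f : CuspForm (Gamma0 N) 2) (hf : IsNewformOf W f) :
    ∃! G : IwasawaAlgebra 2,
      iwasawaToPowerSeries 2 G = padicLFunction f (unitRoot W 2 : ℚ_[2]) :=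
  existsUnique_iwasawaToPowerSeries_eq_padicLFunction_two (W := W) hgo hf hirr

omit [W.IsElliptic] in
/-- **The E2 datum read INSIDE `Λ`.** If `ι G = L₂(f, α, T)` with `G ∈ Λ` (T-INT2), then for a dual
datum `D` and `n : ℕ`: "`ι g = 2ⁿ · L₂` for some `g ∈ char_Λ X`" ⟺ "`2ⁿ · G ∈ char_Λ X`" — because
`ι : Λ ↪ ℚ₂⟦T⟧` is an injective ring map (`iwasawaToPowerSeries_injective`) with `ι(2ⁿ · G) = 2ⁿ · L₂`.
This is the starting point of the PLAN's C25b "UFD step" (`char X ∋ 2ⁿ G ⟺ μ₂(X) ≤ n + μ(G)`),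
carried out in the sibling `X5/TwoAdicTargetsMuGap.lean` (`katoDivisibilityAtTwoUpTo_iff_muGap`).
[cite: MazurTateTeitelbaum1986Invent, §I.12 (Λ ↪ ℚ_p⟦T⟧)] -/
theorem divisibilityUpTo_iff_mem_charIdeal {N : ℕ} [NeZero N] {f : CuspForm (Gamma0 N) 2}
    {G : IwasawaAlgebra 2}
    (hG : iwasawaToPowerSeries 2 G = padicLFunction f (unitRoot W 2 : ℚ_[2]))
    {κ : ZpExtension ℚ 2} {γ : Field.absoluteGaloisGroup ℚ} (D : W.SelmerDualData κ γ) (n : ℕ) :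
    (∃ g ∈ D.charIdeal, iwasawaToPowerSeries 2 g =
        PowerSeries.C ((2 : ℚ_[2]) ^ n) * padicLFunction f (unitRoot W 2 : ℚ_[2])) ↔
      PowerSeries.C ((2 : ℤ_[2]) ^ n) * G ∈ D.charIdeal := by
  have hι : iwasawaToPowerSeries 2 (PowerSeries.C ((2 : ℤ_[2]) ^ n) * G) =
      PowerSeries.C ((2 : ℚ_[2]) ^ n) * padicLFunction f (unitRoot W 2 : ℚ_[2]) := by
    rw [map_mul, hG]
    congr 1
    rw [show iwasawaToPowerSeries 2 (PowerSeries.C ((2 : ℤ_[2]) ^ n)) =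
      PowerSeries.map (PadicInt.Coe.ringHom (p := 2)) (PowerSeries.C ((2 : ℤ_[2]) ^ n)) from rfl,
      PowerSeries.map_C, map_pow, map_ofNat]
  constructor
  · rintro ⟨g, hg, hιg⟩
    have heq : g = PowerSeries.C ((2 : ℤ_[2]) ^ n) * G :=
      iwasawaToPowerSeries_injective 2 (hιg.trans hι.symm)
    rw [← heq]
    exact hg
  · intro h
    exact ⟨_, h, hι⟩

omit [W.IsElliptic] in
/-- **`KatoDivisibilityAtTwoUpTo` read inside `Λ`**: granted T-INT2's `G` (`ι G = L₂`), the E2 target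
at level `k` says: for every cyclotomic datum and dual datum `D` (on O1-go, `ρ_{E,2^∞}` surjective),
`X` is torsion and `2ⁿ · G ∈ char_Λ X` for some `n ≤ k`. Bookkeeping over
`divisibilityUpTo_iff_mem_charIdeal`. [cite: Kato2004Asterisque, Thm. 17.4 (p. 273) (shape)] -/
theorem katoDivisibilityAtTwoUpTo_iff_mem_charIdeal (k : ℕ) {N : ℕ} [NeZero N]
    (f : CuspForm (Gamma0 N) 2) {G : IwasawaAlgebra 2}
    (hG : iwasawaToPowerSeries 2 G = padicLFunction f (unitRoot W 2 : ℚ_[2])) :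
    KatoDivisibilityAtTwoUpTo W k f ↔
      ∀ (κ : ZpExtension ℚ 2) (γ : Field.absoluteGaloisGroup ℚ), κ.IsCyclotomic →
        κ.IsTopGenerator γ → IsCyclotomicVariable 2 γ → IsOrdinaryAt W 2 → IsNewformOf W f →
        TwoAdicSurjective W →
        ∀ D : W.SelmerDualData κ γ, D.IsTorsion ∧
          ∃ n : ℕ, n ≤ k ∧ PowerSeries.C ((2 : ℤ_[2]) ^ n) * G ∈ D.charIdeal := by
  unfold KatoDivisibilityAtTwoUpTo
  refine forall₅_congr fun κ γ _ _ _ ↦ ?_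
  refine forall₃_congr fun _ _ _ ↦ ?_
  refine forall_congr' fun D ↦ and_congr_right fun _ ↦ ?_
  constructor
  · rintro ⟨n, g, hnk, hg, hι⟩
    exact ⟨n, hnk, (divisibilityUpTo_iff_mem_charIdeal W hG D n).1 ⟨g, hg, hι⟩⟩
  · rintro ⟨n, hnk, hmem⟩
    obtain ⟨g, hg, hι⟩ := (divisibilityUpTo_iff_mem_charIdeal W hG D n).2 hmem
    exact ⟨n, g, hnk, hg, hι⟩

/-! ## §3 The END-STATE with `m = 0` by theorem (Abbes–Ullmo at a good `2`) -/

/-- **END-STATE at `2`, good-ordinary half, period slack DISCHARGED**: granted Greenberg@2 (`hEC`,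
in print), modularity, GZK, the E2 target `KatoDivisibilityAtTwoUpTo W k f` at level `N_E`, and the
PUBLISHED Manin-constant fact `abbesUllmo_not_dvd_maninConstant_of_not_dvd_level` (Abbes–Ullmo 1996
Thm. A — supplies `m = 0` through `realPeriodRat_eq_unit_mul_plusPeriod_two_of_abbesUllmo`, since
`2 ∤ N` at a good `2` and `E[2]` is irreducible on the big-image locus): for `r_an = 0`, good ordinary
`2`, `ρ_{E,2^∞}` surjective, `ord₂ #Ш ≤ ord₂ #Ш_an + k`. [cite: AbbesUllmo1996, Thm. A]
[cite: GreenbergVatsal2000, §3 Rem. 3.4] [cite: Miller2011LMS, Def. 1.1] -/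
theorem upperBoundAtTwo_goodOrd_of_kato_of_abbesUllmo
    (hAU : abbesUllmo_not_dvd_maninConstant_of_not_dvd_level)
    (hEC : TwoAdicEulerCharRankZero W 0) (hmod : nonempty_modularParametrizationData)
    (hGZK : rank_eq_analyticRank_of_analyticRank_le_one) (k : ℕ)
    (hK : ∀ [NeZero (W.conductorNorm ℤ)] (f : CuspForm (Gamma0 (W.conductorNorm ℤ)) 2),
      KatoDivisibilityAtTwoUpTo W k f)
    (hr : W.analyticRank = 0) (hgo : GoodOrd W 2) (him : TwoAdicSurjective W) :
    ∃ q : ℚ, shaAn W = (q : ℂ) ∧ (padicValNat 2 W.shaOrder : ℤ) ≤ padicValRat 2 q + k := by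
  have hord : IsOrdinaryAt W 2 := hgo
  exact upperBoundAtTwo_goodOrd_of_kato_of_periodUnit W hEC hmod hGZK k hK
    (fun f hf ↦ realPeriodRat_eq_unit_mul_plusPeriod_two_of_abbesUllmo hAU W hord.1
      (irr_two_of_twoAdicSurjective W him) f hf) hr hgo him

/-- **`BSD(E,2)` per pair on O1-A-go ∧ r0 at `k ≤ 1`, period slack DISCHARGED** (Abbes–Ullmo for
`m = 0`; G9 slack-one consumer with the certified lower bound and the parity certificate).
[cite: AbbesUllmo1996, Thm. A] [cite: Miller2011LMS, Def. 1.1] [cite: SilvermanAEC2009, Thm. X.4.14] -/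
theorem bsdp_two_goodOrd_of_kato_le_one_of_abbesUllmo
    (hAU : abbesUllmo_not_dvd_maninConstant_of_not_dvd_level)
    (hCT : exists_casselsTate_pairing (K := ℚ))
    (hEC : TwoAdicEulerCharRankZero W 0) (hmod : nonempty_modularParametrizationData)
    (hGZK : rank_eq_analyticRank_of_analyticRank_le_one) (k : ℕ) (hk : k ≤ 1)
    (hK : ∀ [NeZero (W.conductorNorm ℤ)] (f : CuspForm (Gamma0 (W.conductorNorm ℤ)) 2),
      KatoDivisibilityAtTwoUpTo W k f)
    (hcm : ¬ W.HasCM) (hr : W.analyticRank = 0) (hgo : GoodOrd W 2) (him : TwoAdicSurjective W)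
    (heven : ShaAnTwoAdicValEven W) (hlow : MissingLowerBoundAt W 2) : BSDp W 2 := by
  have hord : IsOrdinaryAt W 2 := hgo
  exact bsdp_two_goodOrd_of_kato_le_one_of_periodUnit W hCT hEC hmod hGZK k hk hK
    (fun f hf ↦ realPeriodRat_eq_unit_mul_plusPeriod_two_of_abbesUllmo hAU W hord.1
      (irr_two_of_twoAdicSurjective W him) f hf) hcm hr hgo him heven hlow

/-- **END-STATE OF RECORD on O1-A-go ∧ r0 (every hypothesis a PUBLISHED named fact, a class
predicate, a certificate, or the ONE open target).** For a globally minimal non-CM `E/ℚ` of analytic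
rank `0`, good ordinary at `2`, with `ρ_{E,2^∞}` surjective: `BSD(E,2)` follows from
(open target) `KatoDivisibilityAtTwoUpTo W k f` for the newforms at level `N_E` with `k ≤ 1` — Kato's
divisibility at `2` with `2`-power loss at most one, NOT in print;
(certificates) `MissingLowerBoundAt W 2` (descent: `ord₂ #Ш_an ≤ ord₂ #Ш`) and `ShaAnTwoAdicValEven W`
(`ord₂ #Ш_an` even; rank-`0` `L`-value certificate);
(published named facts) Cassels–Tate `exists_casselsTate_pairing`, Greenberg 1999 Thm. 4.1 at every
prime `Greenberg1999.thm41_charValue_rankZero_anyPrime` (⇒ `δ_alg = 0`), modularity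
`nonempty_modularParametrizationData`, Gross–Zagier–Kolyvagin
`rank_eq_analyticRank_of_analyticRank_le_one`, Abbes–Ullmo Thm. A
`abbesUllmo_not_dvd_maninConstant_of_not_dvd_level` (⇒ `m = 0`); and `ν₂ = 0` is a theorem
(`exists_integral_twoAdicLFunction`). Reach: 434 of the 5 275 rank-`0` O1 residue cells (A″ ∩ go, o1
lens-4 GEN 3). Nothing booked. [cite: GreenbergLNM1716, Thm. 4.1 (p. 102)]
[cite: Kato2004Asterisque, Thm. 17.4 (p. 273) (target shape; p = 2 integral clause NOT in print)]
[cite: AbbesUllmo1996, Thm. A] [cite: Miller2011LMS, Def. 1.1] -/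
theorem bsdp_two_goodOrd_of_kato_le_one_of_facts
    (hAU : abbesUllmo_not_dvd_maninConstant_of_not_dvd_level)
    (hCT : exists_casselsTate_pairing (K := ℚ))
    (hGr : Greenberg1999.thm41_charValue_rankZero_anyPrime)
    (hmod : nonempty_modularParametrizationData)
    (hGZK : rank_eq_analyticRank_of_analyticRank_le_one) (k : ℕ) (hk : k ≤ 1)
    (hK : ∀ [NeZero (W.conductorNorm ℤ)] (f : CuspForm (Gamma0 (W.conductorNorm ℤ)) 2),
      KatoDivisibilityAtTwoUpTo W k f)
    (hcm : ¬ W.HasCM) (hr : W.analyticRank = 0) (hgo : GoodOrd W 2) (him : TwoAdicSurjective W)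
    (heven : ShaAnTwoAdicValEven W) (hlow : MissingLowerBoundAt W 2) : BSDp W 2 :=
  bsdp_two_goodOrd_of_kato_le_one_of_abbesUllmo W hAU hCT
    (twoAdicEulerCharRankZero_zero_of_greenberg W hGr) hmod hGZK k hk hK hcm hr hgo him heven hlow

/-- **The period unit on ALL of O1-A (good OR multiplicative `2`, `ρ_{E,2^∞}` surjective)**, for the
multiplicative-at-`2` branch of the END-STATE (G1 `KatoDivisibilityAtTwoMultUpTo`, consumer not yet
typed): `ord₂ ϖ = 0` for every period ratio of every newform of `E`, from Abbes–Ullmo (good `2`) and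
Česnavičius 2018 Thm. 1.2 (`2 ∥ N`) via `padicValRat_two_periodRatio_eq_zero`.
[cite: Cesnavicius2018, Thm. 1.2] [cite: AbbesUllmo1996, Thm. A] [cite: GreenbergVatsal2000, §3 Rem. 3.4] -/
theorem padicValRat_varpi_eq_zero_of_bigImage
    (hAU : abbesUllmo_not_dvd_maninConstant_of_not_dvd_level)
    (hC : cesnavicius_not_two_dvd_maninConstant_of_two_dvd_level)
    (hred : GoodOrd W 2 ∨ Mult W 2) (him : TwoAdicSurjective W) {N : ℕ} [NeZero N]
    (f : CuspForm (Gamma0 N) 2) (hf : IsNewformOf W f) (ϖ : ℚ)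
    (hϖ : (ϖ : ℝ) * W.realPeriodRat = plusPeriod f) : padicValRat 2 ϖ = 0 := by
  have hred' : W.HasGoodReductionAtPrime 2 ∨ W.HasMultiplicativeReductionAtPrime 2 := by
    rcases hred with h | h
    · exact Or.inl (show IsOrdinaryAt W 2 from h).1
    · exact Or.inr h
  exact padicValRat_two_periodRatio_eq_zero hAU hC W hred' (irr_two_of_twoAdicSurjective W him)
    f hf ϖ hϖ

end Summit.BirchSwinnertonDyer.Rank1Residual.X5.O1

end
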